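import Summits.BirchSwinnertonDyer.Rank1Residual.Additive.X3ThreeLineDatum
import Summits.BirchSwinnertonDyer.Rank1Residual.X2.CellAGVParCertificatesN9A
import Mathlib.Tactic.Simproc.Factors
import HarnessLib

/-!
# X3♯(G-ord, `e = 2`) at `p = 3`: kernel records of the per-pair LINE DATUM `X3LineDatumThree W` for the
# Case-1 members of the B-X3G booking list — part C of 16 (cell `bsd-addord`, seat
# `bsd-addord-twist`, strategy = twist transport)

HONEST FRAMING (cell `bsd-addord`, `run/shared/lean/pub/bsd-addord/README.md` §4): the programme's
target of record is the full Birch–Swinnerton-Dyer formula for every `E/ℚ` of analytic rank `≤ 1`.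
DATA-RECORDS module: theorems only (no definition, no named fact, no `sorry`); it BOOKS NOTHING and
moves no mark — booking is the planner's act (TARGET.md v5.5 §8 protocol B-X3G, (iv)).

## What is recorded

For each isogeny class `(N, class, 3)` of the booking list `HOME/bsd-addord-twist-booking-members.tsv`
(kit job j242057; the r_an = 0, non-CM, non-degenerate branch-parity classes of cell (G-ord, `e = 2`) at
`p = 3` in census v2, planner keys `HOME/planner/bx3g/`), the CASE-1 MEMBER `W = [a₁, a₂, a₃, a₄, a₆]`
(Cremona's globally minimal model; the first member in Cremona order carrying the EVEN rational `3`-line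
as a SUB-line) and the theorem `X3LineDatumThree W` — SOME rational `3`-line `Φ₀ ≤ W[3]` which is even,
has non-trivial `Γ_ℚ`-action and `χ_{−3}`-twist ramified at `3` — proved by
`x3LineDatumThree_of_cert_of_delta` from the certificate `(x₀, s, D, q)`: `Ψ₃(x₀) = 0`, `D` squarefree,
`s ≠ 0`, `D·s² = Ψ₂Sq(x₀)`, `0 < D`, `D ≠ 1`, `3 ∤ D` (`norm_num` identities, one prime-factor-list
computation with X2a's helper `squarefree_of_nodup_primeFactorsList_natAbs`, `decide`s). This is the per-pair line-datum input of
`ClassX3Gord.{{missingLowerBoundAt,bsdp}}_three_rankZero_of_facts_of_nonAnomalous`; the class binders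
(`ClassX3Gord W 3`, `¬ HasCM`, `analyticRank = 0`, `ReductionNonAnomalous W 3`) are data of record
(Cremona / the planner's two-engine census), NOT kernel statements here; the other members of each class
are reached by Cassels (`N10.bsdp_of_isIsogenous_of_bsdp`, binder `bsdRHS_eq_of_isIsogenous`). The
docstring of each record names the class, the anomalous bit of the twist `V = W ⊗ χ_{−3}` and `D`
(`φ = χ_D`). Records sorted by conductor.

References: [GreenbergVatsal2000] §2 p. 28 (the line `Φ`); lane file
`HOME/bsd-addord-twist-booking-members.tsv`; `Additive/X3ThreeLineDatum.lean`.
-/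

set_option autoImplicit false

open WeierstrassCurve Polynomial Literature.NumberTheory.EllipticCurves
  Literature.NumberTheory.EllipticCurves.Rank1Residual

namespace Summit.BirchSwinnertonDyer.Rank1Residual.Additive.X3ThreeLineDatumRecords

/-- `37350o2` = `[1,-1,0,-188442,31913716]` (class `37350o`, (G-ord, `e = 2`) at `3`; twist `4150l2`, `a₃(V) = -1`, non-anomalous; even line
`φ = χ_{5}`): `x₀ = 184`, `D = 5`, `s = 1660`, `Ψ₂Sq(x₀) = 13778000` ⇒ `X3LineDatumThree W`. [folklore] -/
theorem x3LineDatumThree_37350o2 : X3LineDatumThree (⟨1, -1, 0, -188442, 31913716⟩ : WeierstrassCurve ℚ) :=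
  x3LineDatumThree_of_cert_of_delta _ (by norm_num [Δ, b₂, b₄, b₆, b₈]) 184 1660 5
    (by simp only [Ψ₃, eval_add, eval_mul, eval_pow, eval_C, eval_X, eval_ofNat]; norm_num [b₂, b₄, b₆, b₈])
    (X2.CellACertN9.squarefree_of_nodup_primeFactorsList_natAbs (by norm_num) (by simp [Nat.primeFactorsList_ofNat])) (by norm_num)
    (by rw [KernelDisc.eval_Ψ₂Sq]; norm_num [b₂, b₄, b₆]) (by decide) (by decide) (by decide)

/-- `38025ba2` = `[0,0,1,-81120,8867641]` (class `38025ba`, (G-ord, `e = 2`) at `3`; twist `4225a2`, `a₃(V) = -1`, non-anomalous; even line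
`φ = χ_{65}`): `x₀ = 195`, `D = 65`, `s = 169`, `Ψ₂Sq(x₀) = 1856465` ⇒ `X3LineDatumThree W`. [folklore] -/
theorem x3LineDatumThree_38025ba2 : X3LineDatumThree (⟨0, 0, 1, -81120, 8867641⟩ : WeierstrassCurve ℚ) :=
  x3LineDatumThree_of_cert_of_delta _ (by norm_num [Δ, b₂, b₄, b₆, b₈]) 195 169 65
    (by simp only [Ψ₃, eval_add, eval_mul, eval_pow, eval_C, eval_X, eval_ofNat]; norm_num [b₂, b₄, b₆, b₈])
    (X2.CellACertN9.squarefree_of_nodup_primeFactorsList_natAbs (by norm_num) (by simp [Nat.primeFactorsList_ofNat])) (by norm_num)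
    (by rw [KernelDisc.eval_Ψ₂Sq]; norm_num [b₂, b₄, b₆]) (by decide) (by decide) (by decide)

/-- `38925g2` = `[0,0,1,-97500,7210156]` (class `38925g`, (G-ord, `e = 2`) at `3`; twist `4325a2`, `a₃(V) = 2`, non-anomalous; even line
`φ = χ_{5}`): `x₀ = 375`, `D = 5`, `s = 4325`, `Ψ₂Sq(x₀) = 93528125` ⇒ `X3LineDatumThree W`. [folklore] -/
theorem x3LineDatumThree_38925g2 : X3LineDatumThree (⟨0, 0, 1, -97500, 7210156⟩ : WeierstrassCurve ℚ) :=
  x3LineDatumThree_of_cert_of_delta _ (by norm_num [Δ, b₂, b₄, b₆, b₈]) 375 4325 5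
    (by simp only [Ψ₃, eval_add, eval_mul, eval_pow, eval_C, eval_X, eval_ofNat]; norm_num [b₂, b₄, b₆, b₈])
    (X2.CellACertN9.squarefree_of_nodup_primeFactorsList_natAbs (by norm_num) (by simp [Nat.primeFactorsList_ofNat])) (by norm_num)
    (by rw [KernelDisc.eval_Ψ₂Sq]; norm_num [b₂, b₄, b₆]) (by decide) (by decide) (by decide)

/-- `40050bi2` = `[1,-1,1,-124655,16979847]` (class `40050bi`, (G-ord, `e = 2`) at `3`; twist `4450b2`, `a₃(V) = -1`, non-anomalous; even line
`φ = χ_{5}`): `x₀ = 184`, `D = 5`, `s = 445`, `Ψ₂Sq(x₀) = 990125` ⇒ `X3LineDatumThree W`. [folklore] -/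
theorem x3LineDatumThree_40050bi2 : X3LineDatumThree (⟨1, -1, 1, -124655, 16979847⟩ : WeierstrassCurve ℚ) :=
  x3LineDatumThree_of_cert_of_delta _ (by norm_num [Δ, b₂, b₄, b₆, b₈]) 184 445 5
    (by simp only [Ψ₃, eval_add, eval_mul, eval_pow, eval_C, eval_X, eval_ofNat]; norm_num [b₂, b₄, b₆, b₈])
    (X2.CellACertN9.squarefree_of_nodup_primeFactorsList_natAbs (by norm_num) (by simp [Nat.primeFactorsList_ofNat])) (by norm_num)
    (by rw [KernelDisc.eval_Ψ₂Sq]; norm_num [b₂, b₄, b₆]) (by decide) (by decide) (by decide)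

/-- `40950q3` = `[1,-1,0,-213417,33481741]` (class `40950q`, (G-ord, `e = 2`) at `3`; twist `4550q3`, `a₃(V) = 2`, non-anomalous; even line
`φ = χ_{5}`): `x₀ = 454`, `D = 5`, `s = 4900`, `Ψ₂Sq(x₀) = 120050000` ⇒ `X3LineDatumThree W`. [folklore] -/
theorem x3LineDatumThree_40950q3 : X3LineDatumThree (⟨1, -1, 0, -213417, 33481741⟩ : WeierstrassCurve ℚ) :=
  x3LineDatumThree_of_cert_of_delta _ (by norm_num [Δ, b₂, b₄, b₆, b₈]) 454 4900 5
    (by simp only [Ψ₃, eval_add, eval_mul, eval_pow, eval_C, eval_X, eval_ofNat]; norm_num [b₂, b₄, b₆, b₈])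
    (X2.CellACertN9.squarefree_of_nodup_primeFactorsList_natAbs (by norm_num) (by simp [Nat.primeFactorsList_ofNat])) (by norm_num)
    (by rw [KernelDisc.eval_Ψ₂Sq]; norm_num [b₂, b₄, b₆]) (by decide) (by decide) (by decide)

/-- `40950u2` = `[1,-1,0,801489933,568213988341]` (class `40950u`, (G-ord, `e = 2`) at `3`; twist `4550p2`, `a₃(V) = -1`, non-anomalous; even line
`φ = χ_{5}`): `x₀ = 10534`, `D = 5`, `s = 2853760`, `Ψ₂Sq(x₀) = 40719730688000` ⇒ `X3LineDatumThree W`. [folklore] -/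
theorem x3LineDatumThree_40950u2 : X3LineDatumThree (⟨1, -1, 0, 801489933, 568213988341⟩ : WeierstrassCurve ℚ) :=
  x3LineDatumThree_of_cert_of_delta _ (by norm_num [Δ, b₂, b₄, b₆, b₈]) 10534 2853760 5
    (by simp only [Ψ₃, eval_add, eval_mul, eval_pow, eval_C, eval_X, eval_ofNat]; norm_num [b₂, b₄, b₆, b₈])
    (X2.CellACertN9.squarefree_of_nodup_primeFactorsList_natAbs (by norm_num) (by simp [Nat.primeFactorsList_ofNat])) (by norm_num)
    (by rw [KernelDisc.eval_Ψ₂Sq]; norm_num [b₂, b₄, b₆]) (by decide) (by decide) (by decide)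

/-- `40950v2` = `[1,-1,0,-13167,3880741]` (class `40950v`, (G-ord, `e = 2`) at `3`; twist `4550o2`, `a₃(V) = -1`, non-anomalous; even line
`φ = χ_{5}`): `x₀ = 4`, `D = 5`, `s = 1750`, `Ψ₂Sq(x₀) = 15312500` ⇒ `X3LineDatumThree W`. [folklore] -/
theorem x3LineDatumThree_40950v2 : X3LineDatumThree (⟨1, -1, 0, -13167, 3880741⟩ : WeierstrassCurve ℚ) :=
  x3LineDatumThree_of_cert_of_delta _ (by norm_num [Δ, b₂, b₄, b₆, b₈]) 4 1750 5
    (by simp only [Ψ₃, eval_add, eval_mul, eval_pow, eval_C, eval_X, eval_ofNat]; norm_num [b₂, b₄, b₆, b₈])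
    (X2.CellACertN9.squarefree_of_nodup_primeFactorsList_natAbs (by norm_num) (by simp [Nat.primeFactorsList_ofNat])) (by norm_num)
    (by rw [KernelDisc.eval_Ψ₂Sq]; norm_num [b₂, b₄, b₆]) (by decide) (by decide) (by decide)

/-- `42075t2` = `[0,0,1,-22350,2941906]` (class `42075t`, (G-ord, `e = 2`) at `3`; twist `4675l2`, `a₃(V) = -1`, non-anomalous; even line
`φ = χ_{5}`): `x₀ = 15`, `D = 5`, `s = 1445`, `Ψ₂Sq(x₀) = 10440125` ⇒ `X3LineDatumThree W`. [folklore] -/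
theorem x3LineDatumThree_42075t2 : X3LineDatumThree (⟨0, 0, 1, -22350, 2941906⟩ : WeierstrassCurve ℚ) :=
  x3LineDatumThree_of_cert_of_delta _ (by norm_num [Δ, b₂, b₄, b₆, b₈]) 15 1445 5
    (by simp only [Ψ₃, eval_add, eval_mul, eval_pow, eval_C, eval_X, eval_ofNat]; norm_num [b₂, b₄, b₆, b₈])
    (X2.CellACertN9.squarefree_of_nodup_primeFactorsList_natAbs (by norm_num) (by simp [Nat.primeFactorsList_ofNat])) (by norm_num)
    (by rw [KernelDisc.eval_Ψ₂Sq]; norm_num [b₂, b₄, b₆]) (by decide) (by decide) (by decide)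

/-- `42300u2` = `[0,0,0,-7091175,6568460750]` (class `42300u`, (G-ord, `e = 2`) at `3`; twist `4700a2`, `a₃(V) = -1`, non-anomalous; even line
`φ = χ_{5}`): `x₀ = 2535`, `D = 5`, `s = 62500`, `Ψ₂Sq(x₀) = 19531250000` ⇒ `X3LineDatumThree W`. [folklore] -/
theorem x3LineDatumThree_42300u2 : X3LineDatumThree (⟨0, 0, 0, -7091175, 6568460750⟩ : WeierstrassCurve ℚ) :=
  x3LineDatumThree_of_cert_of_delta _ (by norm_num [Δ, b₂, b₄, b₆, b₈]) 2535 62500 5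
    (by simp only [Ψ₃, eval_add, eval_mul, eval_pow, eval_C, eval_X, eval_ofNat]; norm_num [b₂, b₄, b₆, b₈])
    (X2.CellACertN9.squarefree_of_nodup_primeFactorsList_natAbs (by norm_num) (by simp [Nat.primeFactorsList_ofNat])) (by norm_num)
    (by rw [KernelDisc.eval_Ψ₂Sq]; norm_num [b₂, b₄, b₆]) (by decide) (by decide) (by decide)

/-- `45675e2` = `[0,0,1,-1600283550,25589857156906]` (class `45675e`, (G-ord, `e = 2`) at `3`; twist `5075d2`, `a₃(V) = -1`, non-anomalous; even line
`φ = χ_{5}`): `x₀ = 14415`, `D = 5`, `s = 2100875`, `Ψ₂Sq(x₀) = 22068378828125` ⇒ `X3LineDatumThree W`. [folklore] -/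
theorem x3LineDatumThree_45675e2 : X3LineDatumThree (⟨0, 0, 1, -1600283550, 25589857156906⟩ : WeierstrassCurve ℚ) :=
  x3LineDatumThree_of_cert_of_delta _ (by norm_num [Δ, b₂, b₄, b₆, b₈]) 14415 2100875 5
    (by simp only [Ψ₃, eval_add, eval_mul, eval_pow, eval_C, eval_X, eval_ofNat]; norm_num [b₂, b₄, b₆, b₈])
    (X2.CellACertN9.squarefree_of_nodup_primeFactorsList_natAbs (by norm_num) (by simp [Nat.primeFactorsList_ofNat])) (by norm_num)
    (by rw [KernelDisc.eval_Ψ₂Sq]; norm_num [b₂, b₄, b₆]) (by decide) (by decide) (by decide)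

/-- `48960bm3` = `[0,0,0,-2401068,281682992]` (class `48960bm`, (G-ord, `e = 2`) at `3`; twist `5440l3`, `a₃(V) = 2`, non-anomalous; even line
`φ = χ_{2}`): `x₀ = 2166`, `D = 2`, `s = 102400`, `Ψ₂Sq(x₀) = 20971520000` ⇒ `X3LineDatumThree W`. [folklore] -/
theorem x3LineDatumThree_48960bm3 : X3LineDatumThree (⟨0, 0, 0, -2401068, 281682992⟩ : WeierstrassCurve ℚ) :=
  x3LineDatumThree_of_cert_of_delta _ (by norm_num [Δ, b₂, b₄, b₆, b₈]) 2166 102400 2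
    (by simp only [Ψ₃, eval_add, eval_mul, eval_pow, eval_C, eval_X, eval_ofNat]; norm_num [b₂, b₄, b₆, b₈])
    Int.prime_two.squarefree (by norm_num)
    (by rw [KernelDisc.eval_Ψ₂Sq]; norm_num [b₂, b₄, b₆]) (by decide) (by decide) (by decide)

/-- `48960db2` = `[0,0,0,12948,2289584]` (class `48960db`, (G-ord, `e = 2`) at `3`; twist `5440a2`, `a₃(V) = -1`, non-anomalous; even line
`φ = χ_{2}`): `x₀ = 6`, `D = 2`, `s = 2176`, `Ψ₂Sq(x₀) = 9469952` ⇒ `X3LineDatumThree W`. [folklore] -/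
theorem x3LineDatumThree_48960db2 : X3LineDatumThree (⟨0, 0, 0, 12948, 2289584⟩ : WeierstrassCurve ℚ) :=
  x3LineDatumThree_of_cert_of_delta _ (by norm_num [Δ, b₂, b₄, b₆, b₈]) 6 2176 2
    (by simp only [Ψ₃, eval_add, eval_mul, eval_pow, eval_C, eval_X, eval_ofNat]; norm_num [b₂, b₄, b₆, b₈])
    Int.prime_two.squarefree (by norm_num)
    (by rw [KernelDisc.eval_Ψ₂Sq]; norm_num [b₂, b₄, b₆]) (by decide) (by decide) (by decide)

/-- `49050bp2` = `[1,-1,1,-5420255,4858460997]` (class `49050bp`, (G-ord, `e = 2`) at `3`; twist `5450d2`, `a₃(V) = -1`, non-anomalous; even line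
`φ = χ_{5}`): `x₀ = 1354`, `D = 5`, `s = 545`, `Ψ₂Sq(x₀) = 1485125` ⇒ `X3LineDatumThree W`. [folklore] -/
theorem x3LineDatumThree_49050bp2 : X3LineDatumThree (⟨1, -1, 1, -5420255, 4858460997⟩ : WeierstrassCurve ℚ) :=
  x3LineDatumThree_of_cert_of_delta _ (by norm_num [Δ, b₂, b₄, b₆, b₈]) 1354 545 5
    (by simp only [Ψ₃, eval_add, eval_mul, eval_pow, eval_C, eval_X, eval_ofNat]; norm_num [b₂, b₄, b₆, b₈])
    (X2.CellACertN9.squarefree_of_nodup_primeFactorsList_natAbs (by norm_num) (by simp [Nat.primeFactorsList_ofNat])) (by norm_num)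
    (by rw [KernelDisc.eval_Ψ₂Sq]; norm_num [b₂, b₄, b₆]) (by decide) (by decide) (by decide)

/-- `49050bs2` = `[1,-1,1,-98263355,374759679147]` (class `49050bs`, (G-ord, `e = 2`) at `3`; twist `5450e2`, `a₃(V) = -1`, non-anomalous; even line
`φ = χ_{5}`): `x₀ = 6304`, `D = 5`, `s = 68125`, `Ψ₂Sq(x₀) = 23205078125` ⇒ `X3LineDatumThree W`. [folklore] -/
theorem x3LineDatumThree_49050bs2 : X3LineDatumThree (⟨1, -1, 1, -98263355, 374759679147⟩ : WeierstrassCurve ℚ) :=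
  x3LineDatumThree_of_cert_of_delta _ (by norm_num [Δ, b₂, b₄, b₆, b₈]) 6304 68125 5
    (by simp only [Ψ₃, eval_add, eval_mul, eval_pow, eval_C, eval_X, eval_ofNat]; norm_num [b₂, b₄, b₆, b₈])
    (X2.CellACertN9.squarefree_of_nodup_primeFactorsList_natAbs (by norm_num) (by simp [Nat.primeFactorsList_ofNat])) (by norm_num)
    (by rw [KernelDisc.eval_Ψ₂Sq]; norm_num [b₂, b₄, b₆]) (by decide) (by decide) (by decide)

/-- `49050bt2` = `[1,-1,1,4045,355047]` (class `49050bt`, (G-ord, `e = 2`) at `3`; twist `5450f2`, `a₃(V) = 2`, non-anomalous; even line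
`φ = χ_{5}`): `x₀ = 4`, `D = 5`, `s = 545`, `Ψ₂Sq(x₀) = 1485125` ⇒ `X3LineDatumThree W`. [folklore] -/
theorem x3LineDatumThree_49050bt2 : X3LineDatumThree (⟨1, -1, 1, 4045, 355047⟩ : WeierstrassCurve ℚ) :=
  x3LineDatumThree_of_cert_of_delta _ (by norm_num [Δ, b₂, b₄, b₆, b₈]) 4 545 5
    (by simp only [Ψ₃, eval_add, eval_mul, eval_pow, eval_C, eval_X, eval_ofNat]; norm_num [b₂, b₄, b₆, b₈])
    (X2.CellACertN9.squarefree_of_nodup_primeFactorsList_natAbs (by norm_num) (by simp [Nat.primeFactorsList_ofNat])) (by norm_num)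
    (by rw [KernelDisc.eval_Ψ₂Sq]; norm_num [b₂, b₄, b₆]) (by decide) (by decide) (by decide)

/-- `51075c2` = `[0,0,1,3750,-13883594]` (class `51075c`, (G-ord, `e = 2`) at `3`; twist `5675a2`, `a₃(V) = -1`, non-anomalous; even line
`φ = χ_{5}`): `x₀ = 375`, `D = 5`, `s = 5675`, `Ψ₂Sq(x₀) = 161028125` ⇒ `X3LineDatumThree W`. [folklore] -/
theorem x3LineDatumThree_51075c2 : X3LineDatumThree (⟨0, 0, 1, 3750, -13883594⟩ : WeierstrassCurve ℚ) :=
  x3LineDatumThree_of_cert_of_delta _ (by norm_num [Δ, b₂, b₄, b₆, b₈]) 375 5675 5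
    (by simp only [Ψ₃, eval_add, eval_mul, eval_pow, eval_C, eval_X, eval_ofNat]; norm_num [b₂, b₄, b₆, b₈])
    (X2.CellACertN9.squarefree_of_nodup_primeFactorsList_natAbs (by norm_num) (by simp [Nat.primeFactorsList_ofNat])) (by norm_num)
    (by rw [KernelDisc.eval_Ψ₂Sq]; norm_num [b₂, b₄, b₆]) (by decide) (by decide) (by decide)

/-- `51714s3` = `[1,-1,1,-156695,23910059]` (class `51714s`, (G-ord, `e = 2`) at `3`; twist `5746e3`, `a₃(V) = -2` — ANOMALOUS (outside the end state as typed); even line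
`φ = χ_{13}`): `x₀ = 244`, `D = 13`, `s = 221`, `Ψ₂Sq(x₀) = 634933` ⇒ `X3LineDatumThree W`. [folklore] -/
theorem x3LineDatumThree_51714s3 : X3LineDatumThree (⟨1, -1, 1, -156695, 23910059⟩ : WeierstrassCurve ℚ) :=
  x3LineDatumThree_of_cert_of_delta _ (by norm_num [Δ, b₂, b₄, b₆, b₈]) 244 221 13
    (by simp only [Ψ₃, eval_add, eval_mul, eval_pow, eval_C, eval_X, eval_ofNat]; norm_num [b₂, b₄, b₆, b₈])
    (X2.CellACertN9.squarefree_of_nodup_primeFactorsList_natAbs (by norm_num) (by simp [Nat.primeFactorsList_ofNat])) (by norm_num)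
    (by rw [KernelDisc.eval_Ψ₂Sq]; norm_num [b₂, b₄, b₆]) (by decide) (by decide) (by decide)

/-- `51984ci2` = `[0,0,0,492765,-1060305374]` (class `51984ci`, (G-ord, `e = 2`) at `3`; twist `5776l2`, `a₃(V) = 1` — ANOMALOUS (outside the end state as typed); even line
`φ = χ_{19}`): `x₀ = 1425`, `D = 19`, `s = 23104`, `Ψ₂Sq(x₀) = 10142101504` ⇒ `X3LineDatumThree W`. [folklore] -/
theorem x3LineDatumThree_51984ci2 : X3LineDatumThree (⟨0, 0, 0, 492765, -1060305374⟩ : WeierstrassCurve ℚ) :=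
  x3LineDatumThree_of_cert_of_delta _ (by norm_num [Δ, b₂, b₄, b₆, b₈]) 1425 23104 19
    (by simp only [Ψ₃, eval_add, eval_mul, eval_pow, eval_C, eval_X, eval_ofNat]; norm_num [b₂, b₄, b₆, b₈])
    (X2.CellACertN9.squarefree_of_nodup_primeFactorsList_natAbs (by norm_num) (by simp [Nat.primeFactorsList_ofNat])) (by norm_num)
    (by rw [KernelDisc.eval_Ψ₂Sq]; norm_num [b₂, b₄, b₆]) (by decide) (by decide) (by decide)

/-- `51984cm2` = `[0,0,0,-13395,597778]` (class `51984cm`, (G-ord, `e = 2`) at `3`; twist `5776m2`, `a₃(V) = 1` — ANOMALOUS (outside the end state as typed); even line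
`φ = χ_{19}`): `x₀ = 57`, `D = 19`, `s = 64`, `Ψ₂Sq(x₀) = 77824` ⇒ `X3LineDatumThree W`. [folklore] -/
theorem x3LineDatumThree_51984cm2 : X3LineDatumThree (⟨0, 0, 0, -13395, 597778⟩ : WeierstrassCurve ℚ) :=
  x3LineDatumThree_of_cert_of_delta _ (by norm_num [Δ, b₂, b₄, b₆, b₈]) 57 64 19
    (by simp only [Ψ₃, eval_add, eval_mul, eval_pow, eval_C, eval_X, eval_ofNat]; norm_num [b₂, b₄, b₆, b₈])
    (X2.CellACertN9.squarefree_of_nodup_primeFactorsList_natAbs (by norm_num) (by simp [Nat.primeFactorsList_ofNat])) (by norm_num)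
    (by rw [KernelDisc.eval_Ψ₂Sq]; norm_num [b₂, b₄, b₆]) (by decide) (by decide) (by decide)

/-- `51984cw2` = `[0,0,0,-485184,138387184]` (class `51984cw`, (G-ord, `e = 2`) at `3`; twist `5776q2`, `a₃(V) = -2` — ANOMALOUS (outside the end state as typed); even line
`φ = χ_{19}`): `x₀ = 228`, `D = 19`, `s = 2888`, `Ψ₂Sq(x₀) = 158470336` ⇒ `X3LineDatumThree W`. [folklore] -/
theorem x3LineDatumThree_51984cw2 : X3LineDatumThree (⟨0, 0, 0, -485184, 138387184⟩ : WeierstrassCurve ℚ) :=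
  x3LineDatumThree_of_cert_of_delta _ (by norm_num [Δ, b₂, b₄, b₆, b₈]) 228 2888 19
    (by simp only [Ψ₃, eval_add, eval_mul, eval_pow, eval_C, eval_X, eval_ofNat]; norm_num [b₂, b₄, b₆, b₈])
    (X2.CellACertN9.squarefree_of_nodup_primeFactorsList_natAbs (by norm_num) (by simp [Nat.primeFactorsList_ofNat])) (by norm_num)
    (by rw [KernelDisc.eval_Ψ₂Sq]; norm_num [b₂, b₄, b₆]) (by decide) (by decide) (by decide)

/-- `53100m2` = `[0,0,0,6900,-194875]` (class `53100m`, (G-ord, `e = 2`) at `3`; twist `5900a2`, `a₃(V) = -1`, non-anomalous; even line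
`φ = χ_{5}`): `x₀ = 60`, `D = 5`, `s = 590`, `Ψ₂Sq(x₀) = 1740500` ⇒ `X3LineDatumThree W`. [folklore] -/
theorem x3LineDatumThree_53100m2 : X3LineDatumThree (⟨0, 0, 0, 6900, -194875⟩ : WeierstrassCurve ℚ) :=
  x3LineDatumThree_of_cert_of_delta _ (by norm_num [Δ, b₂, b₄, b₆, b₈]) 60 590 5
    (by simp only [Ψ₃, eval_add, eval_mul, eval_pow, eval_C, eval_X, eval_ofNat]; norm_num [b₂, b₄, b₆, b₈])
    (X2.CellACertN9.squarefree_of_nodup_primeFactorsList_natAbs (by norm_num) (by simp [Nat.primeFactorsList_ofNat])) (by norm_num)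
    (by rw [KernelDisc.eval_Ψ₂Sq]; norm_num [b₂, b₄, b₆]) (by decide) (by decide) (by decide)

/-- `53235g2` = `[0,0,1,13182,99414]` (class `53235g`, (G-ord, `e = 2`) at `3`; twist `5915f2`, `a₃(V) = 1` — ANOMALOUS (outside the end state as typed); even line
`φ = χ_{13}`): `x₀ = 39`, `D = 13`, `s = 455`, `Ψ₂Sq(x₀) = 2691325` ⇒ `X3LineDatumThree W`. [folklore] -/
theorem x3LineDatumThree_53235g2 : X3LineDatumThree (⟨0, 0, 1, 13182, 99414⟩ : WeierstrassCurve ℚ) :=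
  x3LineDatumThree_of_cert_of_delta _ (by norm_num [Δ, b₂, b₄, b₆, b₈]) 39 455 13
    (by simp only [Ψ₃, eval_add, eval_mul, eval_pow, eval_C, eval_X, eval_ofNat]; norm_num [b₂, b₄, b₆, b₈])
    (X2.CellACertN9.squarefree_of_nodup_primeFactorsList_natAbs (by norm_num) (by simp [Nat.primeFactorsList_ofNat])) (by norm_num)
    (by rw [KernelDisc.eval_Ψ₂Sq]; norm_num [b₂, b₄, b₆]) (by decide) (by decide) (by decide)

/-- `53361ba2` = `[0,0,1,-2632476,-7601160317]` (class `53361ba`, (G-ord, `e = 2`) at `3`; twist `5929b2`, `a₃(V) = -1`, non-anomalous; even line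
`φ = χ_{77}`): `x₀ = 3696`, `D = 77`, `s = 41503`, `Ψ₂Sq(x₀) = 132632423693` ⇒ `X3LineDatumThree W`. [folklore] -/
theorem x3LineDatumThree_53361ba2 : X3LineDatumThree (⟨0, 0, 1, -2632476, -7601160317⟩ : WeierstrassCurve ℚ) :=
  x3LineDatumThree_of_cert_of_delta _ (by norm_num [Δ, b₂, b₄, b₆, b₈]) 3696 41503 77
    (by simp only [Ψ₃, eval_add, eval_mul, eval_pow, eval_C, eval_X, eval_ofNat]; norm_num [b₂, b₄, b₆, b₈])
    (X2.CellACertN9.squarefree_of_nodup_primeFactorsList_natAbs (by norm_num) (by simp [Nat.primeFactorsList_ofNat])) (by norm_num)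
    (by rw [KernelDisc.eval_Ψ₂Sq]; norm_num [b₂, b₄, b₆]) (by decide) (by decide) (by decide)

/-- `54450fh2` = `[1,-1,1,-607685,182484987]` (class `54450fh`, (G-ord, `e = 2`) at `3`; twist `6050i2`, `a₃(V) = 2`, non-anomalous; even line
`φ = χ_{5}`): `x₀ = 454`, `D = 5`, `s = 121`, `Ψ₂Sq(x₀) = 73205` ⇒ `X3LineDatumThree W`. [folklore] -/
theorem x3LineDatumThree_54450fh2 : X3LineDatumThree (⟨1, -1, 1, -607685, 182484987⟩ : WeierstrassCurve ℚ) :=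
  x3LineDatumThree_of_cert_of_delta _ (by norm_num [Δ, b₂, b₄, b₆, b₈]) 454 121 5
    (by simp only [Ψ₃, eval_add, eval_mul, eval_pow, eval_C, eval_X, eval_ofNat]; norm_num [b₂, b₄, b₆, b₈])
    (X2.CellACertN9.squarefree_of_nodup_primeFactorsList_natAbs (by norm_num) (by simp [Nat.primeFactorsList_ofNat])) (by norm_num)
    (by rw [KernelDisc.eval_Ψ₂Sq]; norm_num [b₂, b₄, b₆]) (by decide) (by decide) (by decide)

/-- `56277c2` = `[0,0,1,-35490,2491947]` (class `56277c`, (G-ord, `e = 2`) at `3`; twist `6253a2`, `a₃(V) = 1` — ANOMALOUS (outside the end state as typed); even line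
`φ = χ_{13}`): `x₀ = 156`, `D = 13`, `s = 481`, `Ψ₂Sq(x₀) = 3007693` ⇒ `X3LineDatumThree W`. [folklore] -/
theorem x3LineDatumThree_56277c2 : X3LineDatumThree (⟨0, 0, 1, -35490, 2491947⟩ : WeierstrassCurve ℚ) :=
  x3LineDatumThree_of_cert_of_delta _ (by norm_num [Δ, b₂, b₄, b₆, b₈]) 156 481 13
    (by simp only [Ψ₃, eval_add, eval_mul, eval_pow, eval_C, eval_X, eval_ofNat]; norm_num [b₂, b₄, b₆, b₈])
    (X2.CellACertN9.squarefree_of_nodup_primeFactorsList_natAbs (by norm_num) (by simp [Nat.primeFactorsList_ofNat])) (by norm_num)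
    (by rw [KernelDisc.eval_Ψ₂Sq]; norm_num [b₂, b₄, b₆]) (by decide) (by decide) (by decide)

/-- `56925i2` = `[0,0,1,-10110,391261]` (class `56925i`, (G-ord, `e = 2`) at `3`; twist `6325c2`, `a₃(V) = -1`, non-anomalous; even line
`φ = χ_{5}`): `x₀ = 60`, `D = 5`, `s = 23`, `Ψ₂Sq(x₀) = 2645` ⇒ `X3LineDatumThree W`. [folklore] -/
theorem x3LineDatumThree_56925i2 : X3LineDatumThree (⟨0, 0, 1, -10110, 391261⟩ : WeierstrassCurve ℚ) :=
  x3LineDatumThree_of_cert_of_delta _ (by norm_num [Δ, b₂, b₄, b₆, b₈]) 60 23 5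
    (by simp only [Ψ₃, eval_add, eval_mul, eval_pow, eval_C, eval_X, eval_ofNat]; norm_num [b₂, b₄, b₆, b₈])
    (X2.CellACertN9.squarefree_of_nodup_primeFactorsList_natAbs (by norm_num) (by simp [Nat.primeFactorsList_ofNat])) (by norm_num)
    (by rw [KernelDisc.eval_Ψ₂Sq]; norm_num [b₂, b₄, b₆]) (by decide) (by decide) (by decide)

/-- `57222bp2` = `[1,-1,1,-41734400,103784720163]` (class `57222bp`, (G-ord, `e = 2`) at `3`; twist `6358a2`, `a₃(V) = 2`, non-anomalous; even line
`φ = χ_{17}`): `x₀ = 3685`, `D = 17`, `s = 2312`, `Ψ₂Sq(x₀) = 90870848` ⇒ `X3LineDatumThree W`. [folklore] -/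
theorem x3LineDatumThree_57222bp2 : X3LineDatumThree (⟨1, -1, 1, -41734400, 103784720163⟩ : WeierstrassCurve ℚ) :=
  x3LineDatumThree_of_cert_of_delta _ (by norm_num [Δ, b₂, b₄, b₆, b₈]) 3685 2312 17
    (by simp only [Ψ₃, eval_add, eval_mul, eval_pow, eval_C, eval_X, eval_ofNat]; norm_num [b₂, b₄, b₆, b₈])
    (X2.CellACertN9.squarefree_of_nodup_primeFactorsList_natAbs (by norm_num) (by simp [Nat.primeFactorsList_ofNat])) (by norm_num)
    (by rw [KernelDisc.eval_Ψ₂Sq]; norm_num [b₂, b₄, b₆]) (by decide) (by decide) (by decide)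

/-- `57222d2` = `[1,-1,0,-474507,126511429]` (class `57222d`, (G-ord, `e = 2`) at `3`; twist `6358i2`, `a₃(V) = 2`, non-anomalous; even line
`φ = χ_{17}`): `x₀ = 319`, `D = 17`, `s = 1331`, `Ψ₂Sq(x₀) = 30116537` ⇒ `X3LineDatumThree W`. [folklore] -/
theorem x3LineDatumThree_57222d2 : X3LineDatumThree (⟨1, -1, 0, -474507, 126511429⟩ : WeierstrassCurve ℚ) :=
  x3LineDatumThree_of_cert_of_delta _ (by norm_num [Δ, b₂, b₄, b₆, b₈]) 319 1331 17
    (by simp only [Ψ₃, eval_add, eval_mul, eval_pow, eval_C, eval_X, eval_ofNat]; norm_num [b₂, b₄, b₆, b₈])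
    (X2.CellACertN9.squarefree_of_nodup_primeFactorsList_natAbs (by norm_num) (by simp [Nat.primeFactorsList_ofNat])) (by norm_num)
    (by rw [KernelDisc.eval_Ψ₂Sq]; norm_num [b₂, b₄, b₆]) (by decide) (by decide) (by decide)

/-- `57798h2` = `[1,-1,0,14418,-5310252]` (class `57798h`, (G-ord, `e = 2`) at `3`; twist `6422f2`, `a₃(V) = 1` — ANOMALOUS (outside the end state as typed); even line
`φ = χ_{13}`): `x₀ = 244`, `D = 13`, `s = 1976`, `Ψ₂Sq(x₀) = 50759488` ⇒ `X3LineDatumThree W`. [folklore] -/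
theorem x3LineDatumThree_57798h2 : X3LineDatumThree (⟨1, -1, 0, 14418, -5310252⟩ : WeierstrassCurve ℚ) :=
  x3LineDatumThree_of_cert_of_delta _ (by norm_num [Δ, b₂, b₄, b₆, b₈]) 244 1976 13
    (by simp only [Ψ₃, eval_add, eval_mul, eval_pow, eval_C, eval_X, eval_ofNat]; norm_num [b₂, b₄, b₆, b₈])
    (X2.CellACertN9.squarefree_of_nodup_primeFactorsList_natAbs (by norm_num) (by simp [Nat.primeFactorsList_ofNat])) (by norm_num)
    (by rw [KernelDisc.eval_Ψ₂Sq]; norm_num [b₂, b₄, b₆]) (by decide) (by decide) (by decide)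

/-- `58176s2` = `[0,0,0,-8256,234272]` (class `58176s`, (G-ord, `e = 2`) at `3`; twist `6464h2`, `a₃(V) = 2`, non-anomalous; even line
`φ = χ_{2}`): `x₀ = 96`, `D = 2`, `s = 808`, `Ψ₂Sq(x₀) = 1305728` ⇒ `X3LineDatumThree W`. [folklore] -/
theorem x3LineDatumThree_58176s2 : X3LineDatumThree (⟨0, 0, 0, -8256, 234272⟩ : WeierstrassCurve ℚ) :=
  x3LineDatumThree_of_cert_of_delta _ (by norm_num [Δ, b₂, b₄, b₆, b₈]) 96 808 2
    (by simp only [Ψ₃, eval_add, eval_mul, eval_pow, eval_C, eval_X, eval_ofNat]; norm_num [b₂, b₄, b₆, b₈])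
    Int.prime_two.squarefree (by norm_num)
    (by rw [KernelDisc.eval_Ψ₂Sq]; norm_num [b₂, b₄, b₆]) (by decide) (by decide) (by decide)

/-- `59850eq2` = `[1,-1,1,98320,3753447]` (class `59850eq`, (G-ord, `e = 2`) at `3`; twist `6650c2`, `a₃(V) = 2`, non-anomalous; even line
`φ = χ_{5}`): `x₀ = 94`, `D = 5`, `s = 3325`, `Ψ₂Sq(x₀) = 55278125` ⇒ `X3LineDatumThree W`. [folklore] -/
theorem x3LineDatumThree_59850eq2 : X3LineDatumThree (⟨1, -1, 1, 98320, 3753447⟩ : WeierstrassCurve ℚ) :=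
  x3LineDatumThree_of_cert_of_delta _ (by norm_num [Δ, b₂, b₄, b₆, b₈]) 94 3325 5
    (by simp only [Ψ₃, eval_add, eval_mul, eval_pow, eval_C, eval_X, eval_ofNat]; norm_num [b₂, b₄, b₆, b₈])
    (X2.CellACertN9.squarefree_of_nodup_primeFactorsList_natAbs (by norm_num) (by simp [Nat.primeFactorsList_ofNat])) (by norm_num)
    (by rw [KernelDisc.eval_Ψ₂Sq]; norm_num [b₂, b₄, b₆]) (by decide) (by decide) (by decide)

/-- `59850es2` = `[1,-1,1,1972120,-177635253]` (class `59850es`, (G-ord, `e = 2`) at `3`; twist `6650d2`, `a₃(V) = 2`, non-anomalous; even line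
`φ = χ_{5}`): `x₀ = 634`, `D = 5`, `s = 32585`, `Ψ₂Sq(x₀) = 5308911125` ⇒ `X3LineDatumThree W`. [folklore] -/
theorem x3LineDatumThree_59850es2 : X3LineDatumThree (⟨1, -1, 1, 1972120, -177635253⟩ : WeierstrassCurve ℚ) :=
  x3LineDatumThree_of_cert_of_delta _ (by norm_num [Δ, b₂, b₄, b₆, b₈]) 634 32585 5
    (by simp only [Ψ₃, eval_add, eval_mul, eval_pow, eval_C, eval_X, eval_ofNat]; norm_num [b₂, b₄, b₆, b₈])
    (X2.CellACertN9.squarefree_of_nodup_primeFactorsList_natAbs (by norm_num) (by simp [Nat.primeFactorsList_ofNat])) (by norm_num)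
    (by rw [KernelDisc.eval_Ψ₂Sq]; norm_num [b₂, b₄, b₆]) (by decide) (by decide) (by decide)

/-- `59850et2` = `[1,-1,1,-167914805,484249237197]` (class `59850et`, (G-ord, `e = 2`) at `3`; twist `6650b2`, `a₃(V) = -1`, non-anomalous; even line
`φ = χ_{5}`): `x₀ = 15844`, `D = 5`, `s = 1200325`, `Ψ₂Sq(x₀) = 7203900528125` ⇒ `X3LineDatumThree W`. [folklore] -/
theorem x3LineDatumThree_59850et2 : X3LineDatumThree (⟨1, -1, 1, -167914805, 484249237197⟩ : WeierstrassCurve ℚ) :=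
  x3LineDatumThree_of_cert_of_delta _ (by norm_num [Δ, b₂, b₄, b₆, b₈]) 15844 1200325 5
    (by simp only [Ψ₃, eval_add, eval_mul, eval_pow, eval_C, eval_X, eval_ofNat]; norm_num [b₂, b₄, b₆, b₈])
    (X2.CellACertN9.squarefree_of_nodup_primeFactorsList_natAbs (by norm_num) (by simp [Nat.primeFactorsList_ofNat])) (by norm_num)
    (by rw [KernelDisc.eval_Ψ₂Sq]; norm_num [b₂, b₄, b₆]) (by decide) (by decide) (by decide)

/-- `61632s2` = `[0,0,0,-10380,1527536]` (class `61632s`, (G-ord, `e = 2`) at `3`; twist `6848f2`, `a₃(V) = -1`, non-anomalous; even line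
`φ = χ_{2}`): `x₀ = 6`, `D = 2`, `s = 1712`, `Ψ₂Sq(x₀) = 5861888` ⇒ `X3LineDatumThree W`. [folklore] -/
theorem x3LineDatumThree_61632s2 : X3LineDatumThree (⟨0, 0, 0, -10380, 1527536⟩ : WeierstrassCurve ℚ) :=
  x3LineDatumThree_of_cert_of_delta _ (by norm_num [Δ, b₂, b₄, b₆, b₈]) 6 1712 2
    (by simp only [Ψ₃, eval_add, eval_mul, eval_pow, eval_C, eval_X, eval_ofNat]; norm_num [b₂, b₄, b₆, b₈])
    Int.prime_two.squarefree (by norm_num)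
    (by rw [KernelDisc.eval_Ψ₂Sq]; norm_num [b₂, b₄, b₆]) (by decide) (by decide) (by decide)

/-- `62784z2` = `[0,0,0,10356,1458416]` (class `62784z`, (G-ord, `e = 2`) at `3`; twist `6976e2`, `a₃(V) = 2`, non-anomalous; even line
`φ = χ_{2}`): `x₀ = 6`, `D = 2`, `s = 1744`, `Ψ₂Sq(x₀) = 6083072` ⇒ `X3LineDatumThree W`. [folklore] -/
theorem x3LineDatumThree_62784z2 : X3LineDatumThree (⟨0, 0, 0, 10356, 1458416⟩ : WeierstrassCurve ℚ) :=
  x3LineDatumThree_of_cert_of_delta _ (by norm_num [Δ, b₂, b₄, b₆, b₈]) 6 1744 2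
    (by simp only [Ψ₃, eval_add, eval_mul, eval_pow, eval_C, eval_X, eval_ofNat]; norm_num [b₂, b₄, b₆, b₈])
    Int.prime_two.squarefree (by norm_num)
    (by rw [KernelDisc.eval_Ψ₂Sq]; norm_num [b₂, b₄, b₆]) (by decide) (by decide) (by decide)

/-- `65925c2` = `[0,0,1,-2010,11911]` (class `65925c`, (G-ord, `e = 2`) at `3`; twist `7325b2`, `a₃(V) = 2`, non-anomalous; even line
`φ = χ_{5}`): `x₀ = 60`, `D = 5`, `s = 293`, `Ψ₂Sq(x₀) = 429245` ⇒ `X3LineDatumThree W`. [folklore] -/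
theorem x3LineDatumThree_65925c2 : X3LineDatumThree (⟨0, 0, 1, -2010, 11911⟩ : WeierstrassCurve ℚ) :=
  x3LineDatumThree_of_cert_of_delta _ (by norm_num [Δ, b₂, b₄, b₆, b₈]) 60 293 5
    (by simp only [Ψ₃, eval_add, eval_mul, eval_pow, eval_C, eval_X, eval_ofNat]; norm_num [b₂, b₄, b₆, b₈])
    (X2.CellACertN9.squarefree_of_nodup_primeFactorsList_natAbs (by norm_num) (by simp [Nat.primeFactorsList_ofNat])) (by norm_num)
    (by rw [KernelDisc.eval_Ψ₂Sq]; norm_num [b₂, b₄, b₆]) (by decide) (by decide) (by decide)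

/-- `66240bo2` = `[0,0,0,14892,3035432]` (class `66240bo`, (G-ord, `e = 2`) at `3`; twist `7360m2`, `a₃(V) = -1`, non-anomalous; even line
`φ = χ_{2}`): `x₀ = 6`, `D = 2`, `s = 2500`, `Ψ₂Sq(x₀) = 12500000` ⇒ `X3LineDatumThree W`. [folklore] -/
theorem x3LineDatumThree_66240bo2 : X3LineDatumThree (⟨0, 0, 0, 14892, 3035432⟩ : WeierstrassCurve ℚ) :=
  x3LineDatumThree_of_cert_of_delta _ (by norm_num [Δ, b₂, b₄, b₆, b₈]) 6 2500 2
    (by simp only [Ψ₃, eval_add, eval_mul, eval_pow, eval_C, eval_X, eval_ofNat]; norm_num [b₂, b₄, b₆, b₈])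
    Int.prime_two.squarefree (by norm_num)
    (by rw [KernelDisc.eval_Ψ₂Sq]; norm_num [b₂, b₄, b₆]) (by decide) (by decide) (by decide)

/-- `66924p2` = `[0,0,0,-2539056,1592394388]` (class `66924p`, (G-ord, `e = 2`) at `3`; twist `7436a2`, `a₃(V) = 1` — ANOMALOUS (outside the end state as typed); even line
`φ = χ_{13}`): `x₀ = 624`, `D = 13`, `s = 8788`, `Ψ₂Sq(x₀) = 1003976272` ⇒ `X3LineDatumThree W`. [folklore] -/
theorem x3LineDatumThree_66924p2 : X3LineDatumThree (⟨0, 0, 0, -2539056, 1592394388⟩ : WeierstrassCurve ℚ) :=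
  x3LineDatumThree_of_cert_of_delta _ (by norm_num [Δ, b₂, b₄, b₆, b₈]) 624 8788 13
    (by simp only [Ψ₃, eval_add, eval_mul, eval_pow, eval_C, eval_X, eval_ofNat]; norm_num [b₂, b₄, b₆, b₈])
    (X2.CellACertN9.squarefree_of_nodup_primeFactorsList_natAbs (by norm_num) (by simp [Nat.primeFactorsList_ofNat])) (by norm_num)
    (by rw [KernelDisc.eval_Ψ₂Sq]; norm_num [b₂, b₄, b₆]) (by decide) (by decide) (by decide)

/-- `67275e2` = `[0,0,1,993300,219933031]` (class `67275e`, (G-ord, `e = 2`) at `3`; twist `7475a2`, `a₃(V) = 2`, non-anomalous; even line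
`φ = χ_{5}`): `x₀ = 240`, `D = 5`, `s = 19435`, `Ψ₂Sq(x₀) = 1888596125` ⇒ `X3LineDatumThree W`. [folklore] -/
theorem x3LineDatumThree_67275e2 : X3LineDatumThree (⟨0, 0, 1, 993300, 219933031⟩ : WeierstrassCurve ℚ) :=
  x3LineDatumThree_of_cert_of_delta _ (by norm_num [Δ, b₂, b₄, b₆, b₈]) 240 19435 5
    (by simp only [Ψ₃, eval_add, eval_mul, eval_pow, eval_C, eval_X, eval_ofNat]; norm_num [b₂, b₄, b₆, b₈])
    (X2.CellACertN9.squarefree_of_nodup_primeFactorsList_natAbs (by norm_num) (by simp [Nat.primeFactorsList_ofNat])) (by norm_num)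
    (by rw [KernelDisc.eval_Ψ₂Sq]; norm_num [b₂, b₄, b₆]) (by decide) (by decide) (by decide)

/-- `67626bh2` = `[1,-1,1,-11759,981087]` (class `67626bh`, (G-ord, `e = 2`) at `3`; twist `7514b2`, `a₃(V) = -1`, non-anomalous; even line
`φ = χ_{17}`): `x₀ = 13`, `D = 17`, `s = 442`, `Ψ₂Sq(x₀) = 3321188` ⇒ `X3LineDatumThree W`. [folklore] -/
theorem x3LineDatumThree_67626bh2 : X3LineDatumThree (⟨1, -1, 1, -11759, 981087⟩ : WeierstrassCurve ℚ) :=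
  x3LineDatumThree_of_cert_of_delta _ (by norm_num [Δ, b₂, b₄, b₆, b₈]) 13 442 17
    (by simp only [Ψ₃, eval_add, eval_mul, eval_pow, eval_C, eval_X, eval_ofNat]; norm_num [b₂, b₄, b₆, b₈])
    (X2.CellACertN9.squarefree_of_nodup_primeFactorsList_natAbs (by norm_num) (by simp [Nat.primeFactorsList_ofNat])) (by norm_num)
    (by rw [KernelDisc.eval_Ψ₂Sq]; norm_num [b₂, b₄, b₆]) (by decide) (by decide) (by decide)

/-- `67725n2` = `[0,0,1,172950,36301531]` (class `67725n`, (G-ord, `e = 2`) at `3`; twist `7525a2`, `a₃(V) = 2`, non-anomalous; even line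
`φ = χ_{5}`): `x₀ = 60`, `D = 5`, `s = 6125`, `Ψ₂Sq(x₀) = 187578125` ⇒ `X3LineDatumThree W`. [folklore] -/
theorem x3LineDatumThree_67725n2 : X3LineDatumThree (⟨0, 0, 1, 172950, 36301531⟩ : WeierstrassCurve ℚ) :=
  x3LineDatumThree_of_cert_of_delta _ (by norm_num [Δ, b₂, b₄, b₆, b₈]) 60 6125 5
    (by simp only [Ψ₃, eval_add, eval_mul, eval_pow, eval_C, eval_X, eval_ofNat]; norm_num [b₂, b₄, b₆, b₈])
    (X2.CellACertN9.squarefree_of_nodup_primeFactorsList_natAbs (by norm_num) (by simp [Nat.primeFactorsList_ofNat])) (by norm_num)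
    (by rw [KernelDisc.eval_Ψ₂Sq]; norm_num [b₂, b₄, b₆]) (by decide) (by decide) (by decide)

/-- `69300bi2` = `[0,0,0,155625,-36981250]` (class `69300bi`, (G-ord, `e = 2`) at `3`; twist `7700a2`, `a₃(V) = -1`, non-anomalous; even line
`φ = χ_{5}`): `x₀ = 375`, `D = 5`, `s = 7700`, `Ψ₂Sq(x₀) = 296450000` ⇒ `X3LineDatumThree W`. [folklore] -/
theorem x3LineDatumThree_69300bi2 : X3LineDatumThree (⟨0, 0, 0, 155625, -36981250⟩ : WeierstrassCurve ℚ) :=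
  x3LineDatumThree_of_cert_of_delta _ (by norm_num [Δ, b₂, b₄, b₆, b₈]) 375 7700 5
    (by simp only [Ψ₃, eval_add, eval_mul, eval_pow, eval_C, eval_X, eval_ofNat]; norm_num [b₂, b₄, b₆, b₈])
    (X2.CellACertN9.squarefree_of_nodup_primeFactorsList_natAbs (by norm_num) (by simp [Nat.primeFactorsList_ofNat])) (by norm_num)
    (by rw [KernelDisc.eval_Ψ₂Sq]; norm_num [b₂, b₄, b₆]) (by decide) (by decide) (by decide)

/-- `69696gv2` = `[0,0,0,-336864,75685984]` (class `69696gv`, (G-ord, `e = 2`) at `3`; twist `7744x2`, `a₃(V) = 1` — ANOMALOUS (outside the end state as typed); even line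
`φ = χ_{22}`): `x₀ = 264`, `D = 22`, `s = 968`, `Ψ₂Sq(x₀) = 20614528` ⇒ `X3LineDatumThree W`. [folklore] -/
theorem x3LineDatumThree_69696gv2 : X3LineDatumThree (⟨0, 0, 0, -336864, 75685984⟩ : WeierstrassCurve ℚ) :=
  x3LineDatumThree_of_cert_of_delta _ (by norm_num [Δ, b₂, b₄, b₆, b₈]) 264 968 22
    (by simp only [Ψ₃, eval_add, eval_mul, eval_pow, eval_C, eval_X, eval_ofNat]; norm_num [b₂, b₄, b₆, b₈])
    (X2.CellACertN9.squarefree_of_nodup_primeFactorsList_natAbs (by norm_num) (by simp [Nat.primeFactorsList_ofNat])) (by norm_num)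
    (by rw [KernelDisc.eval_Ψ₂Sq]; norm_num [b₂, b₄, b₆]) (by decide) (by decide) (by decide)

end Summit.BirchSwinnertonDyer.Rank1Residual.Additive.X3ThreeLineDatumRecords
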